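import Literature.NumberTheory.DiophantineGeometry.ShuteFourSquarefulMainCount

/-!
# Shute (2021), §4–§5: the counts `N_𝐚(B)` of diagonal quaternary quadrics and the quantity `Δ(𝐚)`

Fourth companion to `ShuteFourSquareful.lean` by this route (named fact
`Literature.NumberTheory.DiophantineGeometry.Shute2021_theorem11` = Theorem 1.1 of A. Shute,
*Sums of four squareful numbers*, arXiv:2104.06966), continuing `ShuteFourSquarefulMainCount.lean`,
which ends with the identity

  `N(D, B) = Σ_{d ≤ B, d square-free} μ(d) Σ_{𝐲 admissible} N⁺_{𝐬(d,𝐲)²𝐲³}(B)`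

(`Shute2021.mainCountTrunc_eq_sum_moebius_posQuadCount`), the point of §5 at which Theorem 4.2
(= Thm. 1.3, the circle-method asymptotic for `N_𝐚(B)`) is applied. Everything here is PROVED and
elementary; the file supplies the notation of §4 and the bookkeeping facts about it that the
summation of Theorem 4.2 over `(d, 𝐲)` in §5 uses:

* `Shute2021.quadCount` — the paper's `N_𝐚(B) = #{𝐱 ∈ (ℤ_{≠0})⁴ : F_𝐚(𝐱) = 0, |xᵢ| ≤ √(B/|aᵢ|)}`
  of (1.6)/§4 verbatim, and `Shute2021.quadCount_eq_sixteen_mul`: `N_𝐚(B) = 16 N⁺_𝐚(B)`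
  (`Shute2021.posQuadCount` counts `𝐱 ∈ ℕ⁴`; "there are two choices for the sign of `xᵢ`", §1
  after (1.5));
* `Shute2021.posQuadCount_eq_zero_of_lt`: `N⁺_𝐚(B) = 0` as soon as some `|aᵢ| > B`;
* `Shute2021.posQuadCount_sq_mul`: **`N⁺_{c²𝐚}(B) = N⁺_𝐚(⌊B/c²⌋)`** — the identity
  "`N_𝐲(B; 𝐬, s₀) = N_{𝐬²𝐲³}(B/s₀²)`" (§5, display after (5.6)) by which the part `s₀` of the
  Möbius variable coprime to `y₁y₂y₃y₄` rescales the height;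
* `Shute2021.posQuadCount_le_prod_sqrt`, `Shute2021.posQuadCount_le_rpow`: the trivial uniform
  bound `N⁺_𝐚(B) ≤ ∏_{j ≠ i} ⌊√(B/|aⱼ|)⌋ ≤ B^{3/2}` (three coordinates determine the fourth), used to
  cut the `s₀`-sum (see the remark below);
* `Shute2021.posQuadCount_sVec_eq`: in the Möbius parametrization of
  `mainCountTrunc_eq_sum_moebius_posQuadCount` (square-free `d`, `sᵢ = d / gcd(d, |yᵢ|)`), the
  split `d = d₀d₁`, `d₁ = gcd(d, |y₁y₂y₃y₄|)`, has `d₀` coprime to every `yᵢ`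
  (`Shute2021.coprime_div_gcd_prod`; `d₀` is the paper's `s₀`), `𝐬(d, 𝐲) = d₀𝐬(d₁, 𝐲)`
  (`Shute2021.sVec_mul_left`) and hence `N⁺_{𝐬(d,𝐲)²𝐲³}(B) = N⁺_{𝐬(d₁,𝐲)²𝐲³}(⌊B/d₀²⌋)`, with the
  tail bound `≤ (B/d₀²)^{3/2}` (`Shute2021.posQuadCount_sVec_le_rpow`);
* `Shute2021.delta` — `Δ(𝐚) = ∏ᵢ gcd(aᵢ, ∏_{j≠i} aⱼ)` (§1 before Thm. 1.3; §4, notation), with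
  `Shute2021.delta_le_natAbs_prod` (`Δ(𝐚) ≤ |A|`), `Shute2021.delta_pow_three`
  (`Δ(𝐲³) = Δ(𝐲)³`) and **Lemma 4.13** `Shute2021.delta_mul_le`: `Δ(𝐝𝐞) ≤ (d₁d₂d₃d₄)² Δ(𝐞)`,
  proved as in the paper prime by prime (`Shute2021.factorization_delta`:
  `ν_p(Δ(𝐚)) = Σᵢ min(ν_p(aᵢ), Σ_{j≠i} ν_p(aⱼ))`, and the inequality
  `Σᵢ min(δᵢ+εᵢ, Σ_{j≠i}(δⱼ+εⱼ)) ≤ 2Σᵢδᵢ + Σᵢ min(εᵢ, Σ_{j≠i}εⱼ)` of its proof,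
  `Shute2021.sum_min_add_le`). In §5 it gives `Δ(𝐬²𝐲³) ≤ S⁴Δ(𝐲)³`, whence the weights
  `Δ(𝐲)^{3/4}|Y|^{-3/2}` of Lemma 5.3.

*Remark (the `s₀`-sum).* Theorem 4.2 requires `|A| ≤ B^{4/7}`; applied, as in (5.7), to
`N_{𝐬²𝐲³}(B/s₀²)` it needs `|S²Y³| ≤ (B/s₀²)^{4/7}`, which fails for large `s₀`, and the sum
`E₂(D)` of (5.9) is over all `s₀ ∈ ℕ` with `|ω| = 1` (the `s₀`-sum is dropped in the first display
of the proof of Lemma 5.4). The intended argument truncates `s₀`: for `s₀² > B` the count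
vanishes (`posQuadCount_eq_zero_of_lt` after `posQuadCount_sq_mul`), and for `S₀ < s₀ ≤ √B` the
trivial bound `N⁺ ≤ (B/s₀²)^{3/2}` suffices (`Σ_{s₀ > S₀} (B/s₀²)^{3/2} ≪ B^{3/2}S₀^{-2}`, with
`S₀ = B^{1/4}D`); this does not affect the exponent `734/735`. The lemmas of this file are the
inputs of that truncation.

## References

* A. Shute, *Sums of four squareful numbers*, arXiv:2104.06966v1 [math.NT] (2021): §1, (1.6)
  (`N_𝐚(B)`) and the sentence after (1.5) (signs of `xᵢ`); the notation `Δ`, `A` before Thm. 1.3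
  and at the start of §4; Lemma 4.13 (`Δ(𝐝𝐞) ≤ (d₁⋯d₄)²Δ(𝐞)`) with its proof; §5, (5.6) and the
  display after it (`N_𝐲(B; 𝐬, s₀) = N_{𝐬²𝐲³}(B/s₀²)`), (5.7), (5.9) and Lemma 5.4. [Shute2021]
-/

noncomputable section

open Finset

namespace Literature.NumberTheory.DiophantineGeometry

namespace Shute2021

/-! ### The set behind `N⁺_𝐚(B)` -/

/-- The finite set counted by `posQuadCount a B`: `𝐱 ∈ ℕ⁴`, `xᵢ ≥ 1`, `|aᵢ|xᵢ² ≤ B`,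
`Σ aᵢxᵢ² = 0` (inside the box `|xᵢ| ≤ B`). [cite: Shute2021, §1, (1.6)] -/
def posQuadSet (a : Fin 4 → ℤ) (B : ℕ) : Finset (Fin 4 → ℤ) :=
  {x ∈ box (fun _ => B) | (∀ i, 0 < x i ∧ |a i| * x i ^ 2 ≤ (B : ℤ)) ∧ ∑ i, a i * x i ^ 2 = 0}

/-- `N⁺_𝐚(B) = #posQuadSet`. [folklore] -/
theorem posQuadCount_eq_card (a : Fin 4 → ℤ) (B : ℕ) : posQuadCount a B = #(posQuadSet a B) := rfl

/-- Membership in `posQuadSet`. [folklore] -/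
theorem mem_posQuadSet {a : Fin 4 → ℤ} {B : ℕ} {x : Fin 4 → ℤ} :
    x ∈ posQuadSet a B ↔
      x ∈ box (fun _ => B) ∧ (∀ i, 0 < x i ∧ |a i| * x i ^ 2 ≤ (B : ℤ)) ∧ ∑ i, a i * x i ^ 2 = 0 := by
  rw [posQuadSet, mem_filter]

/-- If `aᵢ ≠ 0`, `0 < xᵢ` and `|aᵢ| xᵢ² ≤ B` then `|xᵢ| ≤ B` (the box condition is redundant).
[folklore] -/
theorem abs_le_of_abs_mul_sq_le {a x : ℤ} {B : ℕ} (ha : a ≠ 0) (hx : 0 < x)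
    (h : |a| * x ^ 2 ≤ (B : ℤ)) : |x| ≤ (B : ℤ) := by
  have ha1 : 1 ≤ |a| := Int.one_le_abs ha
  calc |x| = x := abs_of_pos hx
    _ ≤ x ^ 2 := by nlinarith
    _ = 1 * x ^ 2 := (one_mul _).symm
    _ ≤ |a| * x ^ 2 := by gcongr
    _ ≤ B := h

/-- Membership in `posQuadSet` for `𝐚 ∈ (ℤ_{≠0})⁴`: the box condition drops out. [folklore] -/
theorem mem_posQuadSet_iff {a : Fin 4 → ℤ} (ha : ∀ i, a i ≠ 0) {B : ℕ} {x : Fin 4 → ℤ} :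
    x ∈ posQuadSet a B ↔ (∀ i, 0 < x i ∧ |a i| * x i ^ 2 ≤ (B : ℤ)) ∧ ∑ i, a i * x i ^ 2 = 0 := by
  rw [mem_posQuadSet, mem_box]
  constructor
  · rintro ⟨-, h1, h2⟩
    exact ⟨h1, h2⟩
  · rintro ⟨h1, h2⟩
    exact ⟨fun i => abs_le_of_abs_mul_sq_le (ha i) (h1 i).1 (h1 i).2, h1, h2⟩

/-! ### `N_𝐚(B) = 16 N⁺_𝐚(B)` -/

/-- Shute's `N_𝐚(B)` of (1.6) and §4 verbatim: the number of `𝐱 ∈ (ℤ_{≠0})⁴` with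
`F_𝐚(𝐱) = a₁x₁² + ⋯ + a₄x₄² = 0` and `|xᵢ| ≤ Pᵢ = √(B/|aᵢ|)`, i.e. `|aᵢ|xᵢ² ≤ B`, for all `i`
(inside the box `|xᵢ| ≤ B`, which is automatic for `aᵢ ≠ 0`). [cite: Shute2021, §1, (1.6)] -/
def quadCount (a : Fin 4 → ℤ) (B : ℕ) : ℕ :=
  #{x ∈ box (fun _ => B) | (∀ i, x i ≠ 0 ∧ |a i| * x i ^ 2 ≤ (B : ℤ)) ∧ ∑ i, a i * x i ^ 2 = 0}

/-- The sign choices over a positive vector: `{𝐱 : xᵢ = ±pᵢ}` has `16` elements when all `pᵢ > 0`.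
[folklore] -/
theorem card_piFinset_pair {p : Fin 4 → ℤ} (hp : ∀ i, 0 < p i) :
    #(Fintype.piFinset fun i => ({p i, -p i} : Finset ℤ)) = 16 := by
  rw [Fintype.card_piFinset]
  have : ∀ i, #({p i, -p i} : Finset ℤ) = 2 := fun i =>
    card_pair (by have := hp i; omega)
  simp [this]

/-- **`N_𝐚(B) = 16 N⁺_𝐚(B)`**: the map `𝐱 ↦ (|xᵢ|)ᵢ` is `16`-to-`1` from the set of (1.6) onto the
set of `N⁺_𝐚(B)` ("for all `i` there are two choices for the sign of `xᵢ`", §1 after (1.5)).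
[cite: Shute2021, §1, (1.5)–(1.6)] -/
theorem quadCount_eq_sixteen_mul (a : Fin 4 → ℤ) (B : ℕ) :
    quadCount a B = 16 * posQuadCount a B := by
  classical
  set S : Finset (Fin 4 → ℤ) := {x ∈ box (fun _ => B) |
    (∀ i, x i ≠ 0 ∧ |a i| * x i ^ 2 ≤ (B : ℤ)) ∧ ∑ i, a i * x i ^ 2 = 0} with hS
  have hq : quadCount a B = #S := rfl
  set absV : (Fin 4 → ℤ) → (Fin 4 → ℤ) := fun x i => |x i| with habsV
  have hmaps : ∀ x ∈ S, absV x ∈ posQuadSet a B := by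
    intro x hx
    rw [hS, mem_filter, mem_box] at hx
    obtain ⟨hbox, h1, h2⟩ := hx
    rw [mem_posQuadSet, mem_box]
    refine ⟨fun i => by simpa [habsV] using hbox i, fun i => ⟨abs_pos.2 (h1 i).1, ?_⟩, ?_⟩
    · simpa [habsV, sq_abs] using (h1 i).2
    · simpa [habsV, sq_abs] using h2
  rw [hq, posQuadCount_eq_card, card_eq_sum_card_fiberwise hmaps]
  have hfib : ∀ p ∈ posQuadSet a B, #({x ∈ S | absV x = p}) = 16 := by
    intro p hp
    rw [mem_posQuadSet, mem_box] at hp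
    obtain ⟨hpbox, hp1, hp2⟩ := hp
    have hpos : ∀ i, 0 < p i := fun i => (hp1 i).1
    rw [← card_piFinset_pair hpos]
    congr 1
    ext x
    rw [mem_filter, Fintype.mem_piFinset, hS, mem_filter, mem_box]
    constructor
    · rintro ⟨-, hx⟩
      intro i
      have hi : |x i| = p i := congrFun hx i
      rcases (abs_eq (hpos i).le).1 hi with h | h
      · simp [h]
      · simp [h]
    · intro hx
      have hsq : ∀ i, x i ^ 2 = p i ^ 2 := fun i => by
        rcases mem_insert.1 (hx i) with h | h
        · rw [h]
        · rw [mem_singleton.1 h]; ring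
      have habs : ∀ i, |x i| = p i := fun i => by
        rcases mem_insert.1 (hx i) with h | h
        · rw [h, abs_of_pos (hpos i)]
        · rw [mem_singleton.1 h, abs_neg, abs_of_pos (hpos i)]
      refine ⟨⟨fun i => ?_, fun i => ⟨?_, ?_⟩, ?_⟩, funext fun i => habs i⟩
      · exact (habs i).symm ▸ (le_abs_self (p i)).trans (hpbox i)
      · exact abs_pos.1 ((habs i).symm ▸ hpos i)
      · rw [hsq i]; exact (hp1 i).2
      · rw [← hp2]; exact sum_congr rfl fun i _ => by rw [hsq i]
  rw [sum_congr rfl hfib, sum_const, smul_eq_mul, mul_comm]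

/-! ### Vanishing and rescaling of `N⁺_𝐚(B)` -/

/-- `N⁺_𝐚(B) = 0` if `|aᵢ| > B` for some `i` (then `|aᵢ|xᵢ² ≥ |aᵢ| > B`). [folklore] -/
theorem posQuadCount_eq_zero_of_lt {a : Fin 4 → ℤ} {B : ℕ} (h : ∃ i, (B : ℤ) < |a i|) :
    posQuadCount a B = 0 := by
  obtain ⟨i, hi⟩ := h
  rw [posQuadCount_eq_card, card_eq_zero, ← not_nonempty_iff_eq_empty]
  rintro ⟨x, hx⟩
  rw [mem_posQuadSet] at hx
  obtain ⟨-, h1, -⟩ := hx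
  obtain ⟨hx0, hxB⟩ := h1 i
  have h1le : 1 ≤ x i ^ 2 := by nlinarith
  have : |a i| ≤ |a i| * x i ^ 2 := by nlinarith [abs_nonneg (a i)]
  omega

/-- **Rescaling**: `N⁺_{c²𝐚}(B) = N⁺_𝐚(⌊B/c²⌋)` for `c ≥ 1` and `𝐚 ∈ (ℤ_{≠0})⁴`
(`|c²aᵢ|xᵢ² ≤ B ⟺ |aᵢ|xᵢ² ≤ ⌊B/c²⌋`). This is the identity
"`N_𝐲(B; 𝐬, s₀) = N_{𝐬²𝐲³}(B/s₀²)`" of §5. [cite: Shute2021, §5 (display after (5.6))] -/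
theorem posQuadCount_sq_mul {a : Fin 4 → ℤ} (ha : ∀ i, a i ≠ 0) {c : ℕ} (hc : 0 < c) (B : ℕ) :
    posQuadCount (fun i => (c : ℤ) ^ 2 * a i) B = posQuadCount a (B / c ^ 2) := by
  have hc2 : (0 : ℤ) < (c : ℤ) ^ 2 := by positivity
  have hca : ∀ i, (c : ℤ) ^ 2 * a i ≠ 0 := fun i => mul_ne_zero hc2.ne' (ha i)
  rw [posQuadCount_eq_card, posQuadCount_eq_card]
  congr 1
  ext x
  rw [mem_posQuadSet_iff hca, mem_posQuadSet_iff ha]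
  have hcast : (((B / c ^ 2 : ℕ) : ℕ) : ℤ) = (B : ℤ) / (c : ℤ) ^ 2 := by
    rw [Int.natCast_ediv]; push_cast; rfl
  have key : ∀ i, |(c : ℤ) ^ 2 * a i| * x i ^ 2 ≤ (B : ℤ) ↔
      |a i| * x i ^ 2 ≤ (((B / c ^ 2 : ℕ) : ℕ) : ℤ) := by
    intro i
    rw [hcast, Int.le_ediv_iff_mul_le hc2, abs_mul, abs_of_pos hc2]
    constructor <;> intro h <;> nlinarith [h]
  have hsum : ∑ i, (c : ℤ) ^ 2 * a i * x i ^ 2 = (c : ℤ) ^ 2 * ∑ i, a i * x i ^ 2 := by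
    rw [mul_sum]; exact sum_congr rfl fun i _ => by ring
  rw [hsum, mul_eq_zero, or_iff_right hc2.ne']
  exact and_congr_left' (forall_congr' fun i => and_congr_right' (key i))

/-! ### The trivial bound: three coordinates determine the fourth -/

/-- `|a| x² ≤ B` in `ℤ` gives `|a| · |x|² ≤ B` in `ℕ`. [folklore] -/
theorem natAbs_mul_sq_le {a x : ℤ} {B : ℕ} (h : |a| * x ^ 2 ≤ (B : ℤ)) :
    a.natAbs * x.natAbs ^ 2 ≤ B := by
  have h1 : ((a.natAbs * x.natAbs ^ 2 : ℕ) : ℤ) = |a| * x ^ 2 := by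
    push_cast
    rw [sq_abs]
  exact_mod_cast h1.le.trans h

/-- **Trivial uniform bound**: for `𝐚 ∈ (ℤ_{≠0})⁴` and any `i`,
`N⁺_𝐚(B) ≤ ∏_{j ≠ i} ⌊√(B/|aⱼ|)⌋` — the coordinates `xⱼ`, `j ≠ i`, range over
`1 ≤ xⱼ ≤ √(B/|aⱼ|)` and determine `xᵢ > 0` through `aᵢxᵢ² = −Σ_{j≠i} aⱼxⱼ²`. [folklore] -/
theorem posQuadCount_le_prod_sqrt {a : Fin 4 → ℤ} (ha : ∀ j, a j ≠ 0) (B : ℕ) (i : Fin 4) :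
    posQuadCount a B ≤ ∏ j ∈ univ.erase i, Nat.sqrt (B / (a j).natAbs) := by
  classical
  -- the target set
  set T : Finset (Fin 4 → ℤ) := Fintype.piFinset fun j =>
    if j = i then ({0} : Finset ℤ) else Icc (1 : ℤ) (Nat.sqrt (B / (a j).natAbs)) with hT
  have hTcard : #T = ∏ j ∈ univ.erase i, Nat.sqrt (B / (a j).natAbs) := by
    rw [hT, Fintype.card_piFinset, ← mul_prod_erase _ _ (mem_univ i), if_pos rfl,
      card_singleton, one_mul]
    refine prod_congr rfl fun j hj => ?_
    rw [if_neg (ne_of_mem_erase hj), Int.card_Icc]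
    simp
  rw [← hTcard, posQuadCount_eq_card]
  refine card_le_card_of_injOn (fun x => Function.update x i 0) ?_ ?_
  · intro x hx
    rw [mem_coe, mem_posQuadSet_iff ha] at hx
    obtain ⟨h1, -⟩ := hx
    rw [mem_coe, hT, Fintype.mem_piFinset]
    intro j
    by_cases hj : j = i
    · subst hj; simp
    · dsimp only
      rw [if_neg hj, Function.update_of_ne hj, mem_Icc]
      obtain ⟨hx0, hxB⟩ := h1 j
      refine ⟨by omega, ?_⟩
      have hnat : (x j).natAbs ≤ Nat.sqrt (B / (a j).natAbs) := by
        rw [Nat.le_sqrt, ← pow_two, Nat.le_div_iff_mul_le (Int.natAbs_pos.2 (ha j)), mul_comm]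
        exact natAbs_mul_sq_le hxB
      have hxj : x j = ((x j).natAbs : ℤ) := (Int.natAbs_of_nonneg hx0.le).symm
      rw [hxj]
      exact_mod_cast hnat
  · intro x hx x' hx' hxx'
    rw [mem_coe, mem_posQuadSet_iff ha] at hx hx'
    have hoff : ∀ j, j ≠ i → x j = x' j := fun j hj => by
      have := congrFun hxx' j
      dsimp only at this
      rwa [Function.update_of_ne hj, Function.update_of_ne hj] at this
    -- `aᵢ xᵢ² = aᵢ xᵢ'²`
    have hsumx := hx.2
    have hsumx' := hx'.2
    rw [← add_sum_erase _ _ (mem_univ i)] at hsumx hsumx'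
    have herase : ∑ j ∈ univ.erase i, a j * x j ^ 2 = ∑ j ∈ univ.erase i, a j * x' j ^ 2 :=
      sum_congr rfl fun j hj => by rw [hoff j (ne_of_mem_erase hj)]
    have hii : a i * x i ^ 2 = a i * x' i ^ 2 := by linarith
    have hsq : x i ^ 2 = x' i ^ 2 := mul_left_cancel₀ (ha i) hii
    have hxi : x i = x' i := by
      have h := (sq_eq_sq_iff_abs_eq_abs _ _).1 hsq
      rwa [abs_of_pos (hx.1 i).1, abs_of_pos (hx'.1 i).1] at h
    funext j
    by_cases hj : j = i
    · subst hj; exact hxi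
    · exact hoff j hj

/-- `⌊√(B/n)⌋ ≤ B^{1/2}` as reals. [folklore] -/
theorem natSqrt_div_le_rpow (B n : ℕ) : (Nat.sqrt (B / n) : ℝ) ≤ (B : ℝ) ^ (1 / 2 : ℝ) := by
  have h1 : Nat.sqrt (B / n) ≤ Nat.sqrt B := Nat.sqrt_le_sqrt (Nat.div_le_self _ _)
  have h2 : (Nat.sqrt B : ℝ) ≤ (B : ℝ) ^ (1 / 2 : ℝ) := by
    rw [← Real.sqrt_eq_rpow]
    refine Real.le_sqrt_of_sq_le ?_
    exact_mod_cast Nat.sqrt_le' B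
  exact (Nat.cast_le.2 h1).trans h2

/-- **Trivial uniform bound, real form**: `N⁺_𝐚(B) ≤ B^{3/2}` for `𝐚 ∈ (ℤ_{≠0})⁴`. [folklore] -/
theorem posQuadCount_le_rpow {a : Fin 4 → ℤ} (ha : ∀ j, a j ≠ 0) (B : ℕ) :
    (posQuadCount a B : ℝ) ≤ (B : ℝ) ^ (3 / 2 : ℝ) := by
  have h := posQuadCount_le_prod_sqrt ha B 0
  have hB : (0 : ℝ) ≤ (B : ℝ) ^ (1 / 2 : ℝ) := by positivity
  calc (posQuadCount a B : ℝ) ≤ ((∏ j ∈ univ.erase (0 : Fin 4), Nat.sqrt (B / (a j).natAbs) : ℕ) : ℝ) := by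
        exact_mod_cast h
    _ = ∏ j ∈ univ.erase (0 : Fin 4), (Nat.sqrt (B / (a j).natAbs) : ℝ) := by push_cast; rfl
    _ ≤ ∏ _j ∈ univ.erase (0 : Fin 4), (B : ℝ) ^ (1 / 2 : ℝ) :=
        prod_le_prod (fun j _ => by positivity) fun j _ => natSqrt_div_le_rpow B _
    _ = ((B : ℝ) ^ (1 / 2 : ℝ)) ^ 3 := by
        rw [prod_const, card_erase_of_mem (mem_univ _), card_univ, Fintype.card_fin]
    _ = (B : ℝ) ^ (3 / 2 : ℝ) := by
        rw [← Real.rpow_natCast, ← Real.rpow_mul (Nat.cast_nonneg B)]; norm_num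

/-! ### The part of the Möbius variable coprime to `y₁y₂y₃y₄` rescales the height -/

/-- For `d₀` coprime to every `yᵢ`: `sᵢ(d₀d₁, 𝐲) = d₀ · sᵢ(d₁, 𝐲)` (`sᵢ(d, 𝐲) = d / gcd(d, |yᵢ|)`,
`Shute2021.sVec`). [folklore] -/
theorem sVec_mul_left {d₀ d₁ : ℕ} {y : Fin 4 → ℤ} (h : ∀ i, Nat.Coprime d₀ (y i).natAbs)
    (i : Fin 4) : sVec (d₀ * d₁) y i = d₀ * sVec d₁ y i := by
  unfold sVec
  rw [Nat.Coprime.gcd_mul_left_cancel d₁ (h i), Nat.mul_div_assoc _ (Nat.gcd_dvd_left _ _)]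

/-- For square-free `d` and `m ∣ P`, the cofactor `d / gcd(d, P)` is coprime to `m`: a prime
dividing both would divide `gcd(d, P)` as well, hence its square would divide `d`. [folklore] -/
theorem coprime_div_gcd_of_squarefree {d P m : ℕ} (hd : Squarefree d) (hm : m ∣ P) :
    Nat.Coprime (d / Nat.gcd d P) m := by
  have hd0 : d ≠ 0 := hd.ne_zero
  set g := Nat.gcd d P with hg
  have hgd : g ∣ d := Nat.gcd_dvd_left _ _
  have hgd' : d = g * (d / g) := (Nat.mul_div_cancel' hgd).symm
  rw [Nat.coprime_iff_gcd_eq_one]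
  by_contra hne
  obtain ⟨p, hp, hpdvd⟩ := Nat.exists_prime_and_dvd hne
  have hp1 : p ∣ d / g := hpdvd.trans (Nat.gcd_dvd_left _ _)
  have hp2 : p ∣ P := (hpdvd.trans (Nat.gcd_dvd_right _ _)).trans hm
  have hp3 : p ∣ d := hp1.trans (Nat.div_dvd_of_dvd hgd)
  have hpg : p ∣ g := Nat.dvd_gcd hp3 hp2
  have hpp : p * p ∣ d := by rw [hgd']; exact mul_dvd_mul hpg hp1
  exact hp.not_isUnit (hd p hpp)

/-- The split `d = d₀ · d₁`, `d₁ = gcd(d, |y₁y₂y₃y₄|)`, of a square-free `d`: `d₀ = d / d₁` is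
coprime to every `yᵢ`. [folklore] -/
theorem coprime_div_gcd_prod {d : ℕ} (hd : Squarefree d) (y : Fin 4 → ℤ) (i : Fin 4) :
    Nat.Coprime (d / Nat.gcd d (∏ j, y j).natAbs) (y i).natAbs := by
  refine coprime_div_gcd_of_squarefree hd ?_
  rw [show (∏ j, y j).natAbs = ∏ j, (y j).natAbs from map_prod Int.natAbsHom y univ]
  exact dvd_prod_of_mem _ (mem_univ i)

/-- **`N_𝐲(B; 𝐬, s₀) = N_{𝐬²𝐲³}(B/s₀²)` in the Möbius parametrization of
`Shute2021.mainCountTrunc_eq_sum_moebius_posQuadCount`**: for square-free `d` and `𝐲 ∈ (ℤ_{≠0})⁴`,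
writing `d₁ = gcd(d, |y₁y₂y₃y₄|)` and `d₀ = d / d₁` (the part of `d` coprime to `y₁y₂y₃y₄`, Shute's
`s₀`), one has `𝐬(d, 𝐲) = d₀ 𝐬(d₁, 𝐲)` and
`N⁺_{𝐬(d,𝐲)²𝐲³}(B) = N⁺_{𝐬(d₁,𝐲)²𝐲³}(⌊B/d₀²⌋)`. [cite: Shute2021, §5 (display after (5.6))] -/
theorem posQuadCount_sVec_eq {d : ℕ} (hd : Squarefree d) {y : Fin 4 → ℤ} (hy : ∀ i, y i ≠ 0)
    (B : ℕ) :
    posQuadCount (fun i => (sVec d y i : ℤ) ^ 2 * y i ^ 3) B =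
      posQuadCount (fun i => (sVec (Nat.gcd d (∏ j, y j).natAbs) y i : ℤ) ^ 2 * y i ^ 3)
        (B / (d / Nat.gcd d (∏ j, y j).natAbs) ^ 2) := by
  set d₁ := Nat.gcd d (∏ j, y j).natAbs with hd₁
  set d₀ := d / d₁ with hd₀
  have hdd : d = d₀ * d₁ := (Nat.div_mul_cancel (Nat.gcd_dvd_left _ _)).symm
  have hcop : ∀ i, Nat.Coprime d₀ (y i).natAbs := coprime_div_gcd_prod hd y
  have hd0 : 0 < d₀ := Nat.pos_of_ne_zero fun h => hd.ne_zero (by rw [hdd, h, zero_mul])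
  have hd1 : 0 < d₁ := Nat.pos_of_ne_zero fun h => hd.ne_zero (by rw [hdd, h, mul_zero])
  have hs : ∀ i, (sVec d y i : ℤ) ^ 2 * y i ^ 3 =
      (d₀ : ℤ) ^ 2 * ((sVec d₁ y i : ℤ) ^ 2 * y i ^ 3) := fun i => by
    rw [hdd, sVec_mul_left hcop i]; push_cast; ring
  have ha : ∀ i, (sVec d₁ y i : ℤ) ^ 2 * y i ^ 3 ≠ 0 := fun i =>
    mul_ne_zero (pow_ne_zero _ (by exact_mod_cast (sVec_pos hd1 y i).ne')) (pow_ne_zero _ (hy i))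
  simp only [hs]
  exact posQuadCount_sq_mul ha hd0 B

/-- With the trivial bound: `N⁺_{𝐬(d,𝐲)²𝐲³}(B) ≤ (B/d₀²)^{3/2}`, `d₀ = d / gcd(d, |y₁y₂y₃y₄|)` (the
terms of the `s₀`-tail). [folklore] -/
theorem posQuadCount_sVec_le_rpow {d : ℕ} (hd : Squarefree d) {y : Fin 4 → ℤ} (hy : ∀ i, y i ≠ 0)
    (B : ℕ) :
    (posQuadCount (fun i => (sVec d y i : ℤ) ^ 2 * y i ^ 3) B : ℝ) ≤
      ((B : ℝ) / ((d / Nat.gcd d (∏ j, y j).natAbs : ℕ) : ℝ) ^ 2) ^ (3 / 2 : ℝ) := by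
  set d₁ := Nat.gcd d (∏ j, y j).natAbs with hd₁
  set d₀ := d / d₁ with hd₀
  have hdd : d = d₀ * d₁ := (Nat.div_mul_cancel (Nat.gcd_dvd_left _ _)).symm
  have hd0 : 0 < d₀ := Nat.pos_of_ne_zero fun h => hd.ne_zero (by rw [hdd, h, zero_mul])
  have hd1 : 0 < d₁ := Nat.pos_of_ne_zero fun h => hd.ne_zero (by rw [hdd, h, mul_zero])
  have ha : ∀ i, (sVec d₁ y i : ℤ) ^ 2 * y i ^ 3 ≠ 0 := fun i =>
    mul_ne_zero (pow_ne_zero _ (by exact_mod_cast (sVec_pos hd1 y i).ne')) (pow_ne_zero _ (hy i))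
  rw [posQuadCount_sVec_eq hd hy B]
  refine (posQuadCount_le_rpow ha _).trans ?_
  refine Real.rpow_le_rpow (Nat.cast_nonneg _) ?_ (by norm_num)
  rw [le_div_iff₀ (by positivity)]
  exact_mod_cast Nat.div_mul_le_self B (d₀ ^ 2)

/-! ### The quantity `Δ(𝐚)` -/

/-- Shute's `Δ = Δ(𝐚) = ∏ᵢ gcd(aᵢ, ∏_{j≠i} aⱼ)` (as a natural number).
[cite: Shute2021, §4 (Notation); §1 before Thm. 1.3] -/
def delta (a : Fin 4 → ℤ) : ℕ :=
  ∏ i, Nat.gcd (a i).natAbs (∏ j ∈ univ.erase i, (a j).natAbs)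

/-- `Δ(𝐚) ≥ 1` for `𝐚 ∈ (ℤ_{≠0})⁴`. [folklore] -/
theorem delta_pos {a : Fin 4 → ℤ} (ha : ∀ i, a i ≠ 0) : 0 < delta a :=
  prod_pos fun i _ => Nat.gcd_pos_of_pos_left _ (Int.natAbs_pos.2 (ha i))

/-- `Δ(𝐚) ≤ |A| = |a₁a₂a₃a₄|` for `𝐚 ∈ (ℤ_{≠0})⁴` (each factor `gcd(aᵢ, ·) ≤ |aᵢ|`). [folklore] -/
theorem delta_le_natAbs_prod {a : Fin 4 → ℤ} (ha : ∀ i, a i ≠ 0) :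
    delta a ≤ (∏ i, a i).natAbs := by
  have h : (∏ i, a i).natAbs = ∏ i, (a i).natAbs := map_prod Int.natAbsHom a univ
  rw [delta, h]
  exact prod_le_prod' fun i _ => Nat.gcd_le_left _ (Int.natAbs_pos.2 (ha i))

/-- `Δ(𝐲³) = Δ(𝐲)³` (`gcd(m³, n³) = gcd(m, n)³`). [folklore] -/
theorem delta_pow_three (a : Fin 4 → ℤ) : delta (fun i => a i ^ 3) = delta a ^ 3 := by
  unfold delta
  rw [← prod_pow]
  refine prod_congr rfl fun i _ => ?_
  rw [Int.natAbs_pow, ← Nat.pow_gcd_pow]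
  congr 1
  rw [← prod_pow]
  exact prod_congr rfl fun j _ => Int.natAbs_pow _ _

/-! ### Lemma 4.13: `Δ(𝐝𝐞) ≤ (d₁d₂d₃d₄)² Δ(𝐞)` -/

/-- The `p`-adic valuation of `Δ(𝐚)`: `ν_p(Δ(𝐚)) = Σᵢ min(ν_p(aᵢ), Σ_{j≠i} ν_p(aⱼ))` for
`𝐚 ∈ (ℤ_{≠0})⁴` (first display of the proof of Lemma 4.13). [cite: Shute2021, Lemma 4.13 (proof)] -/
theorem factorization_delta {a : Fin 4 → ℤ} (ha : ∀ i, a i ≠ 0) (p : ℕ) :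
    (delta a).factorization p =
      ∑ i, min ((a i).natAbs.factorization p) (∑ j ∈ univ.erase i, (a j).natAbs.factorization p) := by
  have ha0 : ∀ i, (a i).natAbs ≠ 0 := fun i => Int.natAbs_ne_zero.2 (ha i)
  have hprod0 : ∀ i, ∏ j ∈ univ.erase i, (a j).natAbs ≠ 0 := fun i =>
    prod_ne_zero_iff.2 fun j _ => ha0 j
  unfold delta
  rw [Nat.factorization_prod fun i _ => (Nat.gcd_pos_of_pos_left _ (Nat.pos_of_ne_zero (ha0 i))).ne',
    Finset.sum_apply']
  refine sum_congr rfl fun i _ => ?_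
  rw [Nat.factorization_gcd (ha0 i) (hprod0 i), Finsupp.inf_apply,
    Nat.factorization_prod fun j _ => ha0 j, Finset.sum_apply']

/-- The combinatorial inequality of the proof of Lemma 4.13 (for a fixed prime `p`, with
`δᵢ = ν_p(dᵢ)`, `εᵢ = ν_p(eᵢ)`):
`Σᵢ min(δᵢ+εᵢ, Σ_{j≠i}(δⱼ+εⱼ)) ≤ 2Σᵢδᵢ + Σᵢ min(εᵢ, Σ_{j≠i}εⱼ)`. (The paper orders
`ε₁ ≤ ⋯ ≤ ε₄` and distinguishes `ε₁+ε₂+ε₃ ≤ ε₄` or not; here linear arithmetic over the four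
coordinates.) [cite: Shute2021, Lemma 4.13 (proof)] -/
theorem sum_min_add_le (δ ε : Fin 4 → ℕ) :
    ∑ i, min (δ i + ε i) (∑ j ∈ univ.erase i, (δ j + ε j)) ≤
      2 * ∑ i, δ i + ∑ i, min (ε i) (∑ j ∈ univ.erase i, ε j) := by
  -- the sums over `j ≠ i`, written out
  have hu : ∀ i, (∑ j ∈ univ.erase i, (δ j + ε j)) + (δ i + ε i) =
      (δ 0 + ε 0) + (δ 1 + ε 1) + (δ 2 + ε 2) + (δ 3 + ε 3) := fun i => by
    rw [sum_erase_add _ _ (mem_univ i), Fin.sum_univ_four]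
  have he : ∀ i, (∑ j ∈ univ.erase i, ε j) + ε i = ε 0 + ε 1 + ε 2 + ε 3 := fun i => by
    rw [sum_erase_add _ _ (mem_univ i), Fin.sum_univ_four]
  have hu0 : ∑ j ∈ univ.erase 0, (δ j + ε j) = (δ 1 + ε 1) + (δ 2 + ε 2) + (δ 3 + ε 3) := by
    have := hu 0; omega
  have hu1 : ∑ j ∈ univ.erase 1, (δ j + ε j) = (δ 0 + ε 0) + (δ 2 + ε 2) + (δ 3 + ε 3) := by
    have := hu 1; omega
  have hu2 : ∑ j ∈ univ.erase 2, (δ j + ε j) = (δ 0 + ε 0) + (δ 1 + ε 1) + (δ 3 + ε 3) := by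
    have := hu 2; omega
  have hu3 : ∑ j ∈ univ.erase 3, (δ j + ε j) = (δ 0 + ε 0) + (δ 1 + ε 1) + (δ 2 + ε 2) := by
    have := hu 3; omega
  have he0 : ∑ j ∈ univ.erase 0, ε j = ε 1 + ε 2 + ε 3 := by have := he 0; omega
  have he1 : ∑ j ∈ univ.erase 1, ε j = ε 0 + ε 2 + ε 3 := by have := he 1; omega
  have he2 : ∑ j ∈ univ.erase 2, ε j = ε 0 + ε 1 + ε 3 := by have := he 2; omega
  have he3 : ∑ j ∈ univ.erase 3, ε j = ε 0 + ε 1 + ε 2 := by have := he 3; omega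
  rw [Fin.sum_univ_four, Fin.sum_univ_four, Fin.sum_univ_four, hu0, hu1, hu2, hu3, he0, he1, he2,
    he3]
  generalize δ 0 = d0, δ 1 = d1, δ 2 = d2, δ 3 = d3, ε 0 = e0, ε 1 = e1, ε 2 = e2, ε 3 = e3
  omega

/-- **Lemma 4.13 of Shute (2021)**: for `𝐝, 𝐞 ∈ (ℤ_{≠0})⁴`, `Δ(𝐝𝐞) ≤ (d₁d₂d₃d₄)² Δ(𝐞)`, where
`𝐝𝐞 = (d₁e₁, …, d₄e₄)`; in fact `Δ(𝐝𝐞) ∣ (d₁d₂d₃d₄)² Δ(𝐞)`, by comparing `p`-adic valuations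
(`factorization_delta`, `sum_min_add_le`). [cite: Shute2021, Lemma 4.13] -/
theorem delta_mul_dvd {d e : Fin 4 → ℤ} (hd : ∀ i, d i ≠ 0) (he : ∀ i, e i ≠ 0) :
    delta (fun i => d i * e i) ∣ (∏ i, (d i).natAbs) ^ 2 * delta e := by
  have hde : ∀ i, d i * e i ≠ 0 := fun i => mul_ne_zero (hd i) (he i)
  have hd0 : ∀ i, (d i).natAbs ≠ 0 := fun i => Int.natAbs_ne_zero.2 (hd i)
  have he0 : ∀ i, (e i).natAbs ≠ 0 := fun i => Int.natAbs_ne_zero.2 (he i)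
  have hD0 : (∏ i, (d i).natAbs) ≠ 0 := prod_ne_zero_iff.2 fun i _ => hd0 i
  have hD20 : (∏ i, (d i).natAbs) ^ 2 ≠ 0 := pow_ne_zero _ hD0
  rw [← Nat.factorization_le_iff_dvd (delta_pos hde).ne' (mul_ne_zero hD20 (delta_pos he).ne')]
  intro p
  rw [Nat.factorization_mul hD20 (delta_pos he).ne', Finsupp.add_apply, Nat.factorization_pow,
    Finsupp.smul_apply, smul_eq_mul, Nat.factorization_prod fun i _ => hd0 i, Finset.sum_apply',
    factorization_delta hde, factorization_delta he]
  have hsplit : ∀ i, (d i * e i).natAbs.factorization p =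
      (d i).natAbs.factorization p + (e i).natAbs.factorization p := fun i => by
    rw [Int.natAbs_mul, Nat.factorization_mul (hd0 i) (he0 i), Finsupp.add_apply]
  simp only [hsplit]
  exact sum_min_add_le (fun i => (d i).natAbs.factorization p) (fun i => (e i).natAbs.factorization p)

/-- **Lemma 4.13 of Shute (2021)** (inequality form): `Δ(𝐝𝐞) ≤ (d₁d₂d₃d₄)² Δ(𝐞)` for
`𝐝, 𝐞 ∈ (ℤ_{≠0})⁴`. In §5 (proof of Lemma 5.3) it is used as `Δ(𝐬²𝐲³) ≤ S⁴Δ(𝐲³) = S⁴Δ(𝐲)³`.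
[cite: Shute2021, Lemma 4.13] -/
theorem delta_mul_le {d e : Fin 4 → ℤ} (hd : ∀ i, d i ≠ 0) (he : ∀ i, e i ≠ 0) :
    delta (fun i => d i * e i) ≤ (∏ i, (d i).natAbs) ^ 2 * delta e :=
  Nat.le_of_dvd (Nat.mul_pos (pow_pos (prod_pos fun i _ => Int.natAbs_pos.2 (hd i)) _)
    (delta_pos he)) (delta_mul_dvd hd he)

/-- The case of §5: `Δ(𝐬²𝐲³) ≤ (s₁s₂s₃s₄)⁴ Δ(𝐲)³` for `sᵢ ≥ 1` and `yᵢ ≠ 0`.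
[cite: Shute2021, §5, proof of Lemma 5.3 ("we have Δ(𝐬²𝐲³) ≤ S⁴Δ(𝐲³)")] -/
theorem delta_sq_mul_cube_le {s : Fin 4 → ℕ} (hs : ∀ i, 0 < s i) {y : Fin 4 → ℤ}
    (hy : ∀ i, y i ≠ 0) :
    delta (fun i => (s i : ℤ) ^ 2 * y i ^ 3) ≤ (∏ i, s i) ^ 4 * delta y ^ 3 := by
  have h := delta_mul_le (d := fun i => (s i : ℤ) ^ 2) (e := fun i => y i ^ 3)
    (fun i => pow_ne_zero _ (by exact_mod_cast (hs i).ne')) (fun i => pow_ne_zero _ (hy i))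
  rw [delta_pow_three] at h
  refine h.trans (le_of_eq ?_)
  congr 1
  rw [← prod_pow, ← prod_pow]
  refine prod_congr rfl fun i _ => ?_
  rw [Int.natAbs_pow, Int.natAbs_natCast, ← pow_mul]

end Shute2021

end Literature.NumberTheory.DiophantineGeometry
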